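import Summits.Ventures.PercRepro.RankLevelSetLevelEightMult4
import Summits.Ventures.PercRepro.RankLevelSetPlaneTenPrime
import Summits.Ventures.PercRepro.S2FlatTail
import Summits.Ventures.PercRepro.S2SquareGiantCount3
import Summits.Ventures.PercRepro.S4TailFiveHalves
import Summits.Ventures.PercRepro.S4FlatBoundsSharp
import Summits.Ventures.PercRepro.RankLevelSetLevelSevenPartThree
import Summits.Ventures.PercRepro.RankLevelSetLevelEightArithPartThreeZ

/-!
# PercRepro — THEOREM C₈ ON THE PARTITION CHAIN WITH THE THREE-MULTIPLICITY: C-025 AT LEVEL `8` FOR EVERY FINITE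
MATROID AND EVERY `p ≥ 328`, UNCONDITIONAL (p4, gen 15; a feeder for sub-claim S4, owner p9)

p9's level-`8` assembly (`RankLevelSetLevelEightMult4`, `P(8) = 1588`: the split count with night-1's LINEAR
multiplicity) re-assembled on p7's PARTITION-form giant count with the SHARPENED multiplicity `ν + 3·C(ν, 2)`
(`S2.ncard_eRk_eq_ncard_le_le_giant_three'`, S2SquareGiantCount3 — generic in `q`): with the nullity cap
`f = min 159 (8 + d)`, `f′ = min 79 (7 + d)` (S4FlatBoundsSharp), the intersection nullity `ν_∩ = min 72 d` and
`ν₁ = max (⌊(d + ν_∩)/2⌋ + 1) (f′ − 8 + 2)`, p2's LEMMAS T and T4, the 176 polynomial inequalities `level_eight_poly_part3`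
(RankLevelSetLevelEightArithPartThreeA … P, Z) hold from `p ≥ 327` (binding corank `d = 72`). The `Y`-side: the rank-`≤ 8`
sets through their closures (`32·F₈(n) ≤ 2^n` from `n ≥ 220`) and the spanning sets by the `5/2` tail
(`Explicit.sixteen_mul_sum_range_choose_le'`, `5d + 14 ≤ 2n`, which holds for every `d ≤ 184` from `p ≥ 327`).

* **`c025_core_eight_bounded_corank_part3`** — the `e`-free core at level `8`, corank `9 ≤ d ≤ 184`, rank `p ≥ 327`;
* **`c025_eight_of_seven_part3`** — level `7` for all `p ≥ 327` implies level `8` for all `p ≥ 328`;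
* **`c025_eight_large_part3'`** — UNCONDITIONAL over the tree as it stands: level `8` for every `p ≥ 328` (level `7` from
  `c025_seven_large_part3'`, `p ≥ 176`).
Axioms: standard.
-/

open scoped Matroid

namespace PercRepro

namespace ThmN

open Set

variable {α : Type}

/-- `Σ_{k = 3}^{9} g k = g 3 + … + g 9` in `ℚ`. -/
theorem sum_Icc_three_nine_q (g : ℕ → ℚ) :
    ∑ k ∈ Finset.Icc 3 9, g k = g 3 + g 4 + g 5 + g 6 + g 7 + g 8 + g 9 := by
  rw [show (9 : ℕ) = 8 + 1 from rfl, Finset.sum_Icc_succ_top (by norm_num), sum_Icc_three_eight_q]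

/-- **THE RANK-`≤ 8` TAIL THROUGH THE CLOSURES**: `32·(C(n,8)·2^151 + C(n,7)·2^72 + C(n,6)·2^33 + C(n,5)·2^14 +
C(n,4)·2^6 + C(n,3)·2^3 + C(n,2)·2 + n + 1) ≤ 2^n` for every `n ≥ 220`. -/
theorem thirtytwo_mul_flatTail_eight_le (n : ℕ) (hn : 220 ≤ n) :
    32 * (n.choose 8 * 2 ^ 151 + n.choose 7 * 2 ^ 72 + n.choose 6 * 2 ^ 33 + n.choose 5 * 2 ^ 14 +
      n.choose 4 * 2 ^ 6 + n.choose 3 * 2 ^ 3 + n.choose 2 * 2 + n + 1) ≤ 2 ^ n := by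
  induction n, hn using Nat.le_induction with
  | base => simp only [Nat.choose_eq_descFactorial_div_factorial]; norm_num
  | succ n hn ih =>
    have h8 := choose_succ_le_two_mul_of_two_mul_le n 8 (by omega)
    have h7 := choose_succ_le_two_mul_of_two_mul_le n 7 (by omega)
    have h6 := choose_succ_le_two_mul_of_two_mul_le n 6 (by omega)
    have h5 := choose_succ_le_two_mul_of_two_mul_le n 5 (by omega)
    have h4 := choose_succ_le_two_mul_of_two_mul_le n 4 (by omega)
    have h3 := choose_succ_le_two_mul_of_two_mul_le n 3 (by omega)
    have h2 := choose_succ_le_two_mul_of_two_mul_le n 2 (by omega)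
    have hpow : 2 ^ (n + 1) = 2 * 2 ^ n := by ring
    rw [hpow]
    nlinarith [h8, h7, h6, h5, h4, h3, h2, ih]

/-- The intersection nullity at level `8`: every set of rank `≤ 7` of the core has nullity `≤ min 72 d`
(`f(7) ≤ 79`, `f(6) ≤ 39`, `f(5) ≤ 19`, `f(k) ≤ 2^k − 1` below, and the nullity cap `d`). -/
theorem hinter_eight (M : Matroid α) [M.Finite] {d : ℕ} (hd : M.E.encard = M.eRank + d)
    (hfree : ∀ e ∈ M.E, ∃ A ⊆ M.E \ {e}, e ∉ M.closure A ∧ e ∉ M.closure ((M.E \ {e}) \ A)) :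
    ∀ X ⊆ M.E, M.eRk X ≤ ((8 - 1 : ℕ) : ℕ∞) → (X.ncard : ℕ∞) ≤ M.eRk X + (min 72 d : ℕ) := by
  intro X hX hr
  obtain ⟨k, hk⟩ := Matroid.exists_eRk_eq_nat (M := M) hX
  rw [hk] at hr ⊢
  have hk7 : k ≤ 7 := by exact_mod_cast hr
  have hL0 : ∀ e ∈ M.E, ¬ M.IsLoop e := not_isLoop_of_free M hfree
  have hcap : X.ncard ≤ k + d := by
    have h1 := Matroid.encard_le_eRk_add_of_encard_eq hX hd
    rw [hk] at h1
    have hfin : X.Finite := M.ground_finite.subset hX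
    rw [← hfin.cast_ncard_eq] at h1
    exact_mod_cast h1
  have h72 : X.ncard ≤ k + 72 := by
    rcases Nat.lt_or_ge k 5 with h | h
    · have := ncard_add_one_le_two_pow_of_eRk_le M hL0 hfree k X hX (le_of_eq hk)
      interval_cases k <;> omega
    · rcases Nat.lt_or_ge k 6 with h' | h'
      · have hk' : k = 5 := by omega
        subst hk'
        have := ncard_le_nineteen_of_eRk_le_five_of_free M hfree hX (le_of_eq hk)
        omega
      · rcases Nat.lt_or_ge k 7 with h'' | h''
        · have hk' : k = 6 := by omega
          subst hk'
          have := ncard_le_thirtynine_of_eRk_le_six_of_free M hfree hX (le_of_eq hk)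
          omega
        · have hk' : k = 7 := by omega
          subst hk'
          have := ncard_le_seventynine_of_eRk_le_seven_of_free M hfree X hX (le_of_eq hk)
          omega
  have hcard : X.ncard ≤ k + min 72 d := by omega
  exact_mod_cast hcard

/-- **The `e`-free core at level `8`, corank `9 ≤ d ≤ 184`, rank `p ≥ 327`** (the partition count with the sharpened
multiplicity, the nullity cap, `f(8) ≤ 159`, `f(7) ≤ 79`, Lemmas T and T4; the rank-`≤ 8` sets through their closures
and the `5/2` tail on the `Y`-side). -/
theorem c025_core_eight_bounded_corank_part3 (M : Matroid α) [M.Finite] (p d : ℕ) (hp : 327 ≤ p) (hd9 : 9 ≤ d)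
    (hd184 : d ≤ 184) (hR : M.eRank = (p : ℕ∞)) (hn : M.E.ncard = p + d)
    (hfree : ∀ e ∈ M.E, ∃ A ⊆ M.E \ {e}, e ∉ M.closure A ∧ e ∉ M.closure ((M.E \ {e}) \ A)) :
    RLS M p 8 := by
  classical
  have hEcard : M.ground_finite.toFinset.card = p + d := by
    rw [← Set.ncard_eq_toFinset_card _ M.ground_finite]; exact hn
  have hL0 : ∀ e ∈ M.E, ¬ M.IsLoop e := not_isLoop_of_free M hfree
  have hs : ∀ e ∈ M.E, ∀ f ∈ M.E, e ≠ f → M.eRk {e, f} = 2 := by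
    intro e he f hf hef
    have h2 : (2 : ℕ∞) ≤ M.eRk {e, f} :=
      two_le_eRk_of_two_le_ncard_of_free M hfree (pair_subset he hf) (by rw [ncard_pair hef])
    have h3 : M.eRk {e, f} ≤ 2 := by
      have := M.eRk_le_encard {e, f}
      rwa [encard_pair hef] at this
    exact le_antisymm h3 h2
  have hcirc : ∀ C, M.IsCircuit C → 3 ≤ C.encard := three_le_encard_of_circuit M hL0 hs
  have hd : M.E.encard = M.eRank + d := by
    rw [hR, ← M.ground_finite.cast_ncard_eq, hn]
    push_cast
    ring
  have hcap : ∀ X ⊆ M.E, ∀ k : ℕ, M.eRk X ≤ k → X.ncard ≤ k + d := by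
    intro X hX k hr
    have h1 := Matroid.encard_le_eRk_add_of_encard_eq hX hd
    have h2 : X.encard ≤ (k : ℕ∞) + d := h1.trans (by gcongr)
    have hfin : X.Finite := M.ground_finite.subset hX
    rw [← hfin.cast_ncard_eq] at h2
    exact_mod_cast h2
  -- rank-`≤ 8` sets have `≤ min 159 (8 + d)` points, rank-`≤ 7` sets `≤ min 79 (7 + d)`
  have hflat : ∀ X ⊆ M.E, M.eRk X ≤ 8 → X.ncard ≤ min 159 (8 + d) :=
    fun X hX hr => le_min (ncard_le_one_fifty_nine_of_eRk_le_eight_of_free M hfree X hX hr) (hcap X hX 8 hr)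
  have hflat' : ∀ X ⊆ M.E, M.eRk X ≤ ((8 - 1 : ℕ) : ℕ∞) → X.ncard ≤ min 79 (7 + d) :=
    fun X hX hr => le_min (ncard_le_seventynine_of_eRk_le_seven_of_free M hfree X hX (by simpa using hr))
      (hcap X hX 7 (by simpa using hr))
  have hinter := hinter_eight M hd hfree
  have hC1 : ∀ L ⊆ M.E, M.eRk L = 2 → L.ncard ≤ 3 :=
    fun L hL hr => ncard_le_three_of_eRk_two M hs hfree hL hr
  have hC1' : ∀ L ⊆ M.E, M.eRk L ≤ 2 → L.ncard ≤ 3 := by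
    intro L hL' hr
    have := ncard_add_one_le_two_pow_of_eRk_le M hL0 hfree 2 L hL' hr
    omega
  have hC2 : ∀ P ⊆ M.E, M.eRk P ≤ 3 → P.ncard ≤ 6 :=
    fun P hP hr => ncard_le_six_of_eRk_le_three_of_free M hfree hP hr
  have hs3 : {C | M.IsCircuit C ∧ C.ncard = 3}.ncard ≤ d * (d + 1) / 2 := by
    have hT : 2 * {C | M.IsCircuit C ∧ C.ncard = 3}.ncard ≤ d * (d + 1) := S1.two_mul_ncard_triangles_le M hC1 hd
    omega
  have hs4 : {C | M.IsCircuit C ∧ C.ncard = 4}.ncard ≤ d * (d + 1) * (d + 2) / 3 := by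
    have hT4 : 3 * {C : Set α | M.IsCircuit C ∧ C.ncard = 4}.ncard ≤ d * (d + 1) * (d + 2) :=
      S1.three_mul_ncard_four_circuits_le M hC1' hC2 hd
    omega
  have hs5 : {C | M.IsCircuit C ∧ C.ncard = 5}.ncard ≤ (d + 4).choose 5 :=
    Matroid.ncard_circuits_le_choose_of_encard M hd 4
  have hs6 : {C | M.IsCircuit C ∧ C.ncard = 6}.ncard ≤ (d + 5).choose 6 :=
    Matroid.ncard_circuits_le_choose_of_encard M hd 5
  have hs7 : {C | M.IsCircuit C ∧ C.ncard = 7}.ncard ≤ (d + 6).choose 7 :=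
    Matroid.ncard_circuits_le_choose_of_encard M hd 6
  have hs8 : {C | M.IsCircuit C ∧ C.ncard = 8}.ncard ≤ (d + 7).choose 8 :=
    Matroid.ncard_circuits_le_choose_of_encard M hd 7
  have hs9 : {C | M.IsCircuit C ∧ C.ncard = 9}.ncard ≤ (d + 8).choose 9 :=
    Matroid.ncard_circuits_le_choose_of_encard M hd 8
  -- (U): the partition count with the three-multiplicity, in `ℚ`, then the circuit bounds
  have hU0 := S2.ncard_eRk_eq_ncard_le_le_giant_three' M 8 (min 159 (8 + d)) (min 79 (7 + d))
    (max ((d + min 72 d) / 2 + 1) (min 71 (d - 1) + 2)) (min 72 d)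
    (by norm_num) hcirc hC1 hflat hflat' hinter hd (by omega) (by omega) (by omega)
  have hU1 := Matroid.topCount_le_ncard_compl (M := M) hR hd 8
  have hm1 : min (min 159 (8 + d) - (8 + 1)) (max ((d + min 72 d) / 2 + 1) (min 71 (d - 1) + 2) - 2) =
      min 150 (max ((d + min 72 d) / 2 + 1) (min 71 (d - 1) + 2) - 2) := by omega
  have hm2 : min 79 (7 + d) - 8 = min 71 (d - 1) := by omega
  have hm3 : min (min 159 (8 + d)) (8 + d) = min 159 (8 + d) := by omega
  rw [hn, sum_Icc_three_nine_q, sum_Icc_three_nine_q, hm1, hm2, hm3,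
    show d - (8 + 1) + 1 = d - 8 by omega] at hU0
  simp only [show (8 : ℕ) + 1 = 9 from rfl, show (9 : ℕ) - 3 = 6 from rfl, show (9 : ℕ) - 4 = 5 from rfl,
    show (9 : ℕ) - 5 = 4 from rfl, show (9 : ℕ) - 6 = 3 from rfl, show (9 : ℕ) - 7 = 2 from rfl,
    show (9 : ℕ) - 8 = 1 from rfl, show (9 : ℕ) - 9 = 0 from rfl, Nat.choose_one_right,
    Nat.choose_zero_right] at hU0
  have hUq : (Matroid.topCount M p 8 : ℚ) ≤ ((p + d).choose 8 : ℚ) +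
      (∑ j ∈ Finset.range (d - 8), ((Nat.choose (min 150 (max ((d + min 72 d) / 2 + 1) (min 71 (d - 1) + 2) - 2)) j : ℕ) : ℚ) / (((j + 1) + 3 * (j + 1).choose 2 : ℕ) : ℚ)) *
        (((d * (d + 1) / 2 : ℕ) : ℚ) * ((p + d).choose 6 : ℚ) + ((d * (d + 1) * (d + 2) / 3 : ℕ) : ℚ) * ((p + d).choose 5 : ℚ) +
          (((d + 4).choose 5 : ℕ) : ℚ) * ((p + d).choose 4 : ℚ) + (((d + 5).choose 6 : ℕ) : ℚ) * ((p + d).choose 3 : ℚ) +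
          (((d + 6).choose 7 : ℕ) : ℚ) * ((p + d).choose 2 : ℚ) + (((d + 7).choose 8 : ℕ) : ℚ) * (p + d : ℚ) +
          (((d + 8).choose 9 : ℕ) : ℚ)) +
      ((∑ j ∈ Finset.range (d - 8), ((Nat.choose (min 159 (8 + d) - 9) j : ℕ) : ℚ) / (((j + 1) + 3 * (j + 1).choose 2 : ℕ) : ℚ)) -
        (∑ j ∈ Finset.range (d - 8), ((Nat.choose (min 71 (d - 1)) j : ℕ) : ℚ) / (((j + 1) + 3 * (j + 1).choose 2 : ℕ) : ℚ))) *
        ((d * (d + 1) / 2 * (min 159 (8 + d)).choose 6 + d * (d + 1) * (d + 2) / 3 * (min 159 (8 + d)).choose 5 +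
          (d + 4).choose 5 * (min 159 (8 + d)).choose 4 + (d + 5).choose 6 * (min 159 (8 + d)).choose 3 +
          (d + 6).choose 7 * (min 159 (8 + d)).choose 2 + (d + 7).choose 8 * (min 159 (8 + d)) +
          (d + 8).choose 9 : ℕ) : ℚ) := by
    have hU1q : (Matroid.topCount M p 8 : ℚ) ≤
        ({B : Set α | B ⊆ M.E ∧ M.eRk B = 8 ∧ B.ncard ≤ d}.ncard : ℚ) := by exact_mod_cast hU1
    have hsm : {C | M.IsCircuit C ∧ C.ncard = 3}.ncard * (p + d).choose 6 +
        {C | M.IsCircuit C ∧ C.ncard = 4}.ncard * (p + d).choose 5 +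
        {C | M.IsCircuit C ∧ C.ncard = 5}.ncard * (p + d).choose 4 +
        {C | M.IsCircuit C ∧ C.ncard = 6}.ncard * (p + d).choose 3 +
        {C | M.IsCircuit C ∧ C.ncard = 7}.ncard * (p + d).choose 2 +
        {C | M.IsCircuit C ∧ C.ncard = 8}.ncard * (p + d) + {C | M.IsCircuit C ∧ C.ncard = 9}.ncard * 1 ≤
        d * (d + 1) / 2 * (p + d).choose 6 + d * (d + 1) * (d + 2) / 3 * (p + d).choose 5 +
          (d + 4).choose 5 * (p + d).choose 4 + (d + 5).choose 6 * (p + d).choose 3 +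
          (d + 6).choose 7 * (p + d).choose 2 + (d + 7).choose 8 * (p + d) + (d + 8).choose 9 := by
      have := hs9
      gcongr
      omega
    have hgg : {C | M.IsCircuit C ∧ C.ncard = 3}.ncard * (min 159 (8 + d)).choose 6 +
        {C | M.IsCircuit C ∧ C.ncard = 4}.ncard * (min 159 (8 + d)).choose 5 +
        {C | M.IsCircuit C ∧ C.ncard = 5}.ncard * (min 159 (8 + d)).choose 4 +
        {C | M.IsCircuit C ∧ C.ncard = 6}.ncard * (min 159 (8 + d)).choose 3 +
        {C | M.IsCircuit C ∧ C.ncard = 7}.ncard * (min 159 (8 + d)).choose 2 +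
        {C | M.IsCircuit C ∧ C.ncard = 8}.ncard * (min 159 (8 + d)) + {C | M.IsCircuit C ∧ C.ncard = 9}.ncard * 1 ≤
        d * (d + 1) / 2 * (min 159 (8 + d)).choose 6 + d * (d + 1) * (d + 2) / 3 * (min 159 (8 + d)).choose 5 +
          (d + 4).choose 5 * (min 159 (8 + d)).choose 4 + (d + 5).choose 6 * (min 159 (8 + d)).choose 3 +
          (d + 6).choose 7 * (min 159 (8 + d)).choose 2 + (d + 7).choose 8 * (min 159 (8 + d)) + (d + 8).choose 9 := by
      gcongr
      omega
    have hsmq : (({C | M.IsCircuit C ∧ C.ncard = 3}.ncard : ℚ) * ((p + d).choose 6 : ℚ) +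
        ({C | M.IsCircuit C ∧ C.ncard = 4}.ncard : ℚ) * ((p + d).choose 5 : ℚ) +
        ({C | M.IsCircuit C ∧ C.ncard = 5}.ncard : ℚ) * ((p + d).choose 4 : ℚ) +
        ({C | M.IsCircuit C ∧ C.ncard = 6}.ncard : ℚ) * ((p + d).choose 3 : ℚ) +
        ({C | M.IsCircuit C ∧ C.ncard = 7}.ncard : ℚ) * ((p + d).choose 2 : ℚ) +
        ({C | M.IsCircuit C ∧ C.ncard = 8}.ncard : ℚ) * ((p + d : ℕ) : ℚ) +
        ({C | M.IsCircuit C ∧ C.ncard = 9}.ncard : ℚ) * ((1 : ℕ) : ℚ)) ≤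
        ((d * (d + 1) / 2 * (p + d).choose 6 + d * (d + 1) * (d + 2) / 3 * (p + d).choose 5 +
          (d + 4).choose 5 * (p + d).choose 4 + (d + 5).choose 6 * (p + d).choose 3 +
          (d + 6).choose 7 * (p + d).choose 2 + (d + 7).choose 8 * (p + d) + (d + 8).choose 9 : ℕ) : ℚ) := by
      exact_mod_cast hsm
    have hggq : (({C | M.IsCircuit C ∧ C.ncard = 3}.ncard : ℚ) * ((min 159 (8 + d)).choose 6 : ℚ) +
        ({C | M.IsCircuit C ∧ C.ncard = 4}.ncard : ℚ) * ((min 159 (8 + d)).choose 5 : ℚ) +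
        ({C | M.IsCircuit C ∧ C.ncard = 5}.ncard : ℚ) * ((min 159 (8 + d)).choose 4 : ℚ) +
        ({C | M.IsCircuit C ∧ C.ncard = 6}.ncard : ℚ) * ((min 159 (8 + d)).choose 3 : ℚ) +
        ({C | M.IsCircuit C ∧ C.ncard = 7}.ncard : ℚ) * ((min 159 (8 + d)).choose 2 : ℚ) +
        ({C | M.IsCircuit C ∧ C.ncard = 8}.ncard : ℚ) * ((min 159 (8 + d) : ℕ) : ℚ) +
        ({C | M.IsCircuit C ∧ C.ncard = 9}.ncard : ℚ) * ((1 : ℕ) : ℚ)) ≤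
        ((d * (d + 1) / 2 * (min 159 (8 + d)).choose 6 + d * (d + 1) * (d + 2) / 3 * (min 159 (8 + d)).choose 5 +
          (d + 4).choose 5 * (min 159 (8 + d)).choose 4 + (d + 5).choose 6 * (min 159 (8 + d)).choose 3 +
          (d + 6).choose 7 * (min 159 (8 + d)).choose 2 + (d + 7).choose 8 * (min 159 (8 + d)) +
          (d + 8).choose 9 : ℕ) : ℚ) := by exact_mod_cast hgg
    have hσ : (∑ j ∈ Finset.range (d - 8), ((Nat.choose (min 71 (d - 1)) j : ℕ) : ℚ) / (((j + 1) + 3 * (j + 1).choose 2 : ℕ) : ℚ)) ≤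
        ∑ j ∈ Finset.range (d - 8), ((Nat.choose (min 159 (8 + d) - 9) j : ℕ) : ℚ) / (((j + 1) + 3 * (j + 1).choose 2 : ℕ) : ℚ) := by
      apply Finset.sum_le_sum
      intro j _
      have : (min 71 (d - 1)).choose j ≤ (min 159 (8 + d) - 9).choose j := Nat.choose_le_choose j (by omega)
      have h' : ((min 71 (d - 1)).choose j : ℚ) ≤ ((min 159 (8 + d) - 9).choose j : ℚ) := by exact_mod_cast this
      exact div_le_div_of_nonneg_right h' (by positivity)
    have hσm0 : (0 : ℚ) ≤ ∑ j ∈ Finset.range (d - 8), ((Nat.choose (min 150 (max ((d + min 72 d) / 2 + 1) (min 71 (d - 1) + 2) - 2)) j : ℕ) : ℚ) / (((j + 1) + 3 * (j + 1).choose 2 : ℕ) : ℚ) :=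
      Finset.sum_nonneg (fun j _ => by positivity)
    refine hU1q.trans (hU0.trans ?_)
    have e1 := mul_le_mul_of_nonneg_left hsmq hσm0
    have e2 := mul_le_mul_of_nonneg_left hggq (by linarith : (0 : ℚ) ≤
      (∑ j ∈ Finset.range (d - 8), ((Nat.choose (min 159 (8 + d) - 9) j : ℕ) : ℚ) / (((j + 1) + 3 * (j + 1).choose 2 : ℕ) : ℚ)) -
        (∑ j ∈ Finset.range (d - 8), ((Nat.choose (min 71 (d - 1)) j : ℕ) : ℚ) / (((j + 1) + 3 * (j + 1).choose 2 : ℕ) : ℚ)))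
    push_cast at e1 e2 ⊢
    linarith
  -- (Y): the rank-`≤ 8` sets through their closures; the spanning sets by the `5/2` tail
  have hY := Matroid.two_pow_le_midCount_add (M := M) p 8 hR
  have hsum8 := S2.ncard_eRk_le_le_sum M 8
  simp only [Finset.sum_range_succ, Finset.sum_range_zero, zero_add] at hsum8
  have h8 : {X : Set α | X ⊆ M.E ∧ M.eRk X = (8 : ℕ)}.ncard ≤ M.E.ncard.choose 8 * 2 ^ (159 - 8) :=
    S2.ncard_eRk_eq_le_choose_mul_two_pow M 8 159
      (fun X hX hr => ncard_le_one_fifty_nine_of_eRk_le_eight_of_free M hfree X hX (by exact_mod_cast hr))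
  have h7 : {X : Set α | X ⊆ M.E ∧ M.eRk X = (7 : ℕ)}.ncard ≤ M.E.ncard.choose 7 * 2 ^ (79 - 7) :=
    S2.ncard_eRk_eq_le_choose_mul_two_pow M 7 79
      (fun X hX hr => ncard_le_seventynine_of_eRk_le_seven_of_free M hfree X hX (by exact_mod_cast hr))
  have h6 : {X : Set α | X ⊆ M.E ∧ M.eRk X = (6 : ℕ)}.ncard ≤ M.E.ncard.choose 6 * 2 ^ (39 - 6) :=
    S2.ncard_eRk_eq_le_choose_mul_two_pow M 6 39
      (fun X hX hr => ncard_le_thirtynine_of_eRk_le_six_of_free M hfree hX (by exact_mod_cast hr))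
  have h5 : {X : Set α | X ⊆ M.E ∧ M.eRk X = (5 : ℕ)}.ncard ≤ M.E.ncard.choose 5 * 2 ^ (19 - 5) :=
    S2.ncard_eRk_eq_le_choose_mul_two_pow M 5 19
      (fun X hX hr => ncard_le_nineteen_of_eRk_le_five_of_free M hfree hX (by exact_mod_cast hr))
  have h4 : {X : Set α | X ⊆ M.E ∧ M.eRk X = (4 : ℕ)}.ncard ≤ M.E.ncard.choose 4 * 2 ^ (10 - 4) :=
    S2.ncard_eRk_eq_le_choose_mul_two_pow M 4 10
      (fun X hX hr => ncard_le_ten_of_eRk_le_four_of_free M hfree hX (by exact_mod_cast hr))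
  have h3 : {X : Set α | X ⊆ M.E ∧ M.eRk X = (3 : ℕ)}.ncard ≤ M.E.ncard.choose 3 * 2 ^ (6 - 3) :=
    S2.ncard_eRk_eq_le_choose_mul_two_pow M 3 6
      (fun X hX hr => ncard_le_six_of_eRk_le_three_of_free M hfree hX (by exact_mod_cast hr))
  have h2 : {X : Set α | X ⊆ M.E ∧ M.eRk X = (2 : ℕ)}.ncard ≤ M.E.ncard.choose 2 * 2 ^ (3 - 2) :=
    S2.ncard_eRk_eq_le_choose_mul_two_pow M 2 3
      (fun X hX hr => by
        have := ncard_add_one_le_two_pow_of_eRk_le M hL0 hfree 2 X hX hr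
        omega)
  have h1 : {X : Set α | X ⊆ M.E ∧ M.eRk X = (1 : ℕ)}.ncard ≤ M.E.ncard.choose 1 * 2 ^ (1 - 1) :=
    S2.ncard_eRk_eq_le_choose_mul_two_pow M 1 1
      (fun X hX hr => by
        have := ncard_add_one_le_two_pow_of_eRk_le M hL0 hfree 1 X hX hr
        omega)
  have h0 : {X : Set α | X ⊆ M.E ∧ M.eRk X = (0 : ℕ)}.ncard ≤ M.E.ncard.choose 0 * 2 ^ (0 - 0) :=
    S2.ncard_eRk_eq_le_choose_mul_two_pow M 0 0
      (fun X hX hr => by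
        have := ncard_add_one_le_two_pow_of_eRk_le M hL0 hfree 0 X hX hr
        omega)
  norm_num [Nat.choose_one_right] at h8 h7 h6 h5 h4 h3 h2 h1 h0
  rw [hn] at h8 h7 h6 h5 h4 h3 h2 h1
  have hA : {X : Set α | X ⊆ M.E ∧ M.eRk X ≤ 8}.ncard ≤
      (p + d).choose 8 * 2 ^ 151 + (p + d).choose 7 * 2 ^ 72 + (p + d).choose 6 * 2 ^ 33 + (p + d).choose 5 * 2 ^ 14 +
        (p + d).choose 4 * 2 ^ 6 + (p + d).choose 3 * 2 ^ 3 + (p + d).choose 2 * 2 + (p + d) + 1 := by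
    push_cast at hsum8
    omega
  have hB := Matroid.ncard_spanning_le (M := M) hd
  rw [hEcard] at hY hB
  have hT1 := thirtytwo_mul_flatTail_eight_le (p + d) (by omega)
  have hT2 := Explicit.sixteen_mul_sum_range_choose_le' d (p + d) (by omega)
  have hAB : 8 * ({X : Set α | X ⊆ M.E ∧ M.eRk X ≤ 8}.ncard +
      {X : Set α | X ⊆ M.E ∧ M.eRk X = M.eRank}.ncard) ≤ 2 ^ (p + d) := by
    omega
  have hΦ := phiK_le_two_pow_div p 8
  rw [Nat.choose_symm_add] at hΦ
  have hpolyq := level_eight_poly_part3 d hd9 hd184 p hp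
  rw [add_assoc] at hpolyq hUq
  rw [RLS_iff]
  have hYq : (2 : ℚ) ^ (p + d) ≤ (Matroid.midCount M p 8 : ℚ) +
      ({X : Set α | X ⊆ M.E ∧ M.eRk X ≤ 8}.ncard : ℚ) +
      ({X : Set α | X ⊆ M.E ∧ M.eRk X = M.eRank}.ncard : ℚ) := by exact_mod_cast hY
  have hABq : 8 * (({X : Set α | X ⊆ M.E ∧ M.eRk X ≤ 8}.ncard : ℚ) +
      ({X : Set α | X ⊆ M.E ∧ M.eRk X = M.eRank}.ncard : ℚ)) ≤ 2 ^ (p + d) := by exact_mod_cast hAB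
  have hU0' : (0 : ℚ) ≤ (Matroid.topCount M p 8 : ℚ) := Nat.cast_nonneg _
  have hd8 : 8 ≤ d := by omega
  exact level_arith (p := p) (d := d) (n := p + d) (q := 8) rfl hd8 hΦ hU0' hUq hYq hABq hpolyq

/-- **THEOREM C₈ ON THE PARTITION CHAIN, GIVEN LEVEL `7` FROM `P`**: for every `P ≥ 327`, level `7` for all `p ≥ P`
implies level `8` for all `p ≥ P + 1`. -/
theorem c025_eight_of_seven_part3_from (P : ℕ) (hP : 327 ≤ P)
    (h7 : ∀ (M : Matroid α) [M.Finite] (p : ℕ), P ≤ p → RLS M p 7) :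
    ∀ (M : Matroid α) [M.Finite] (p : ℕ), P + 1 ≤ p → RLS M p 8 := by
  intro M _ p hp
  refine rls_succ_large (α := α) 7 8 P ?_ ?_ ?_ M p hp (by omega)
  · intro M' _ p' hP' _
    exact h7 M' p' hP'
  · intro M' _ p' _ hn _
    rcases Nat.lt_or_ge M'.E.ncard (p' + 8) with h | h
    · exact RLS_of_ncard_lt M' h
    · exact RLS_of_ncard_eq M' (by omega)
  · intro M' _ p' hP' hR hbig _ hfree
    rcases Nat.lt_or_ge M'.E.ncard (p' + 185) with h | h
    · exact c025_core_eight_bounded_corank_part3 M' p' (M'.E.ncard - p') (by omega) (by omega) (by omega) hR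
        (by omega) hfree
    · exact c025_core_eight_beyond_one_eighty_four M' p' (by omega) hR (by omega) hfree

/-- **THEOREM C₈ ON THE PARTITION CHAIN, GIVEN LEVEL `7` FROM `327`**: level `7` for all `p ≥ 327` implies level `8`
for all `p ≥ 328`. -/
theorem c025_eight_of_seven_part3 (h7 : ∀ (M : Matroid α) [M.Finite] (p : ℕ), 327 ≤ p → RLS M p 7) :
    ∀ (M : Matroid α) [M.Finite] (p : ℕ), 328 ≤ p → RLS M p 8 :=
  c025_eight_of_seven_part3_from 327 le_rfl h7

/-- **THEOREM C₈ AT `328`, UNCONDITIONAL OVER THE TREE**: every finite matroid satisfies C-025 at level `8` for every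
`p ≥ 328` — level `7` for `p ≥ 176` (`c025_seven_large_part3'`) through the wrapper at `P = 327`. -/
theorem c025_eight_large_part3' (M : Matroid α) [M.Finite] (p : ℕ) (hp : 328 ≤ p) : RLS M p 8 :=
  c025_eight_of_seven_part3 (fun M' _ p' hp' => c025_seven_large_part3' M' p' (by omega)) M p hp

/-- The same in the literal `C025` body: `phiK p 8 · #U(p, 8) ≤ #Y(p, 8)` for every finite matroid and every `p ≥ 328`. -/
theorem c025_eight_large_part3 (M : Matroid α) [M.Finite] (p : ℕ) (hp : 328 ≤ p) :
    phiK p 8 * ({A : Set α | A ⊆ M.E ∧ M.eRk A = (p : ℕ∞) ∧ M.eRk (M.E \ A) = (8 : ℕ∞)}.ncard : ℚ) ≤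
      ({A : Set α | A ⊆ M.E ∧ (8 : ℕ∞) < M.eRk A ∧ M.eRk A < (p : ℕ∞)}.ncard : ℚ) :=
  c025_eight_large_part3' M p hp

end ThmN

end PercRepro
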